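import Summits.Ventures.YMGap.RobustBall.LocalSourceScreeningMetric
import Summits.Ventures.YMGap.RobustBall.UniformMassGapKR
import HarnessLib

/-!
# Venture YMGap, track ROBUST-BALL (Y2) — two members with a LOCALISED difference; the one state is the limit of
# the states of the TRUNCATED actions, at the clustering rate

HONEST FRAMING. WHAT THIS IS: a venture file (cell `pub-ymgap`, track Y2 ROBUST-BALL, seat rb-p1, theorems only), two
corollaries of the screening estimate `abs_integral_sub_integral_le_of_source_profile` (`LocalSourceScreening.lean`):

* `abs_integral_sub_integral_le_of_members_profile` — TWO MEMBERS with a common support family: `(W₁, supp)` a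
  Dobrushin contraction over `perturbedNbr supp` (rows `≤ ρ < 1`), `W₂` ANY bounded adapted potential listed by `supp`,
  whose DIFFERENCE `W₂ − W₁` has one-link oscillation loads `≤ bV ≤ B` vanishing where a profile `ℓ` (growing by at
  most `1` along `perturbedNbr supp`) is nonzero: every DLR `μ` of `W₁` and EVERY DLR `ν` of `W₂` satisfy
  `|∫ f dμ − ∫ f dν| ≤ (√N/2 · min(B,4))/(1 − ρ) · Σ_{y ∈ Δ} ρ^{ℓ y} δ_y` — the LOCALISED form of ds-1's
  `StateStability.abs_integral_sub_integral_le_of_members` (which is the case `ℓ ≡ 0`).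
* ★ `abs_integral_sub_integral_le_of_truncation` — THE THERMODYNAMIC LIMIT OF THE ACTION AT THE CLUSTERING RATE: let
  `W₂` be ANY truncation of the member `W` of range `R` that keeps every term inside the box of radius `n`
  (`W₂ X = W X` whenever all links of `X` have `‖base‖_∞ ≤ n`) and kills or keeps each other term
  (`W₂ X = W X ∨ W₂ X = 0`) — e.g. the finite-volume actions of the van Hove sequence of boxes, with the terms
  straddling the boundary kept or dropped at will.  Then for every DLR state `μ` of `W` (oscillation load `ε₀`) and
  EVERY DLR state `ν` of `W₂`, every local Lipschitz `f` on `Δ`: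
  `|∫ f dμ − ∫ f dν| ≤ (√N/2 · min(ε₀,4))/(1 − ρ) · Σ_{y ∈ Δ} ρ^{⌊(n − ‖y‖_∞)₊/max(1,R)⌋} δ_y`; for a Lipschitz cylinder
  `F` on links inside the box of radius `n₀ ≤ n` the exponential reading
  `≤ (√N/2 · min(ε₀,4))/(1 − max(ρ,½)) · e^{κ} · e^{−(κ/max(1,R)) (n − n₀)} · #Λ · K_F`, `κ = −log max(ρ,½)`
  (`abs_integral_sub_integral_le_of_truncation_cylinder`): the states of the truncated actions converge to the one
  state exponentially fast in the depth `n − n₀`, at the clustering rate of `UniformMassGapKR`, uniformly in the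
  way the boundary terms are treated.  `SU(2)`, `ℤ⁴`, uniformly on `MemBallZd ε₀ ε₁ R` with the closed-form door:
  `su2_truncation_dim4` (`√2 · min(ε₀,4)/(1−ρ) · e^{−((1−ρ)/max(1,R))(n − n₀)} · #Λ · K_F`).
This is the ACTION-side twin of ds-3's boundary-condition insensitivity (`BoundaryDecay.lean`: kernels
`γ_Λ(·|η)` vs the one state); together: the one state of a ball member is reached at the clustering rate along any
van Hove sequence of finite-volume actions with any boundary fields.
WHAT THIS IS NOT: one-sided Dobrushin-comparison rates; lattice strong coupling only, nothing about the continuum limit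
or a Clay-sense mass gap.
-/

noncomputable section

open MeasureTheory Filter Function ProbabilityTheory Real Topology
open scoped NNReal
open Literature.Probability.LatticeModels
open Literature.Probability.LatticeModels.DobrushinMetric
open Literature.MathematicalPhysics.QuantumLattice
open Literature.MathematicalPhysics.QuantumFieldTheory hiding ZdEdge Site
open Summit.QuantumFields.BalabanUV.InfraRed.StrongCouplingPoincareDoorSUN (OneLinkPoincareSUN
  oneLinkPoincareSUN_two_sharp)

namespace Summit.Ventures.YMGap.RobustBall

variable {d N : ℕ}

/-! ### Two members with a localised difference -/

/-- **Two members, localised difference.**  `(W₁, supp)` a Dobrushin contraction over `perturbedNbr supp` with rows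
`≤ ρ < 1`; `W₂` any bounded adapted potential listed by `supp`; one-link oscillation witnesses `oscD` of `W₂ − W₁`
with per-link loads `≤ bV ≤ B`, `bV = 0` where the profile `ℓ` (growing by `≤ 1` along `perturbedNbr supp`) is
nonzero.  Then every DLR `μ` of `W₁` and every DLR `ν` of `W₂` satisfy
`|∫ f dμ − ∫ f dν| ≤ (√N/2 · min(B,4))/(1 − ρ) · Σ_{y ∈ Δ} ρ^{ℓ y} δ_y`. -/
theorem abs_integral_sub_integral_le_of_members_profile (hd : 1 ≤ d) {β ρ : ℝ}
    {W₁ W₂ : Potential (ZdEdge d) (Matrix.specialUnitaryGroup (Fin N) ℂ)} (hW₁ : W₁.IsAdapted)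
    (hW₁b : ∀ X, ∃ C, ∀ U, |W₁ X U| ≤ C) (hW₂ : W₂.IsAdapted) (hW₂b : ∀ X, ∃ C, ∀ U, |W₂ X U| ≤ C)
    {supp : Finset (ZdEdge d) → Finset (Finset (ZdEdge d))} (hsupp₁ : W₁.IsSupportedBy supp)
    (hsupp₂ : W₂.IsSupportedBy supp) {C : ZdEdge d → ZdEdge d → ℝ}
    (hKR : IsKRContraction (perturbedYM (d := d) (fundamentalRep (Fin N)) (N * β) W₁ supp) suFrobDist
      (perturbedNbr supp) C)
    (hrow : ∀ x, ∑ y ∈ perturbedNbr supp x, C x y ≤ ρ) (hρ : ρ < 1)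
    {oscD : Finset (ZdEdge d) → ZdEdge d → ℝ} (hoscD : ∀ X, Dobrushin.IsOscBound ((W₂ - W₁) X) (oscD X))
    {bV : ZdEdge d → ℝ} (hbV : ∀ e, ∑ X ∈ (supp {e}).filter (fun X => e ∈ X), oscD X e ≤ bV e)
    {B : ℝ} (hB : ∀ e, bV e ≤ B)
    (ℓ : ZdEdge d → ℕ) (hℓV : ∀ e, ℓ e ≠ 0 → bV e ≤ 0) (hℓ : ∀ x, ∀ y ∈ perturbedNbr supp x, ℓ x ≤ ℓ y + 1)
    {μ ν : Measure (LGConfig d (Matrix.specialUnitaryGroup (Fin N) ℂ))}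
    (hμ : μ ∈ perturbedGibbsMeasures (d := d) (fundamentalRep (Fin N)) (N * β) W₁ supp)
    (hν : ν ∈ perturbedGibbsMeasures (d := d) (fundamentalRep (Fin N)) (N * β) W₂ supp)
    {f : LGConfig d (Matrix.specialUnitaryGroup (Fin N) ℂ) → ℝ} (hfm : Measurable f)
    {Δ : Finset (ZdEdge d)} (hfdep : DependsOn f (↑Δ : Set (ZdEdge d))) {M : ℝ} (hM : ∀ σ, |f σ| ≤ M)
    {δ : ZdEdge d → ℝ} (hδ : IsLipBound suFrobDist f δ) :
    |(∫ σ, f σ ∂μ) - ∫ σ, f σ ∂ν| ≤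
      Real.sqrt N / 2 * min B 4 / (1 - ρ) * ∑ y ∈ Δ, ρ ^ ℓ y * δ y := by
  -- the source `V = W₂ − W₁`, listed by `supp`; `W₁ + V = W₂`, `supp ∪ supp = supp`
  have hV : (W₂ - W₁).IsAdapted := fun X =>
    ⟨fun σ τ h => by simp only [Pi.sub_apply, (hW₂ X).1 h, (hW₁ X).1 h], (hW₂ X).2.sub (hW₁ X).2⟩
  have hVb : ∀ X, ∃ C, ∀ U, |(W₂ - W₁) X U| ≤ C := fun X => by
    obtain ⟨C₁, h₁⟩ := hW₁b X; obtain ⟨C₂, h₂⟩ := hW₂b X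
    exact ⟨C₂ + C₁, fun U => (abs_sub _ _).trans (add_le_add (h₂ U) (h₁ U))⟩
  have hsuppV : (W₂ - W₁).IsSupportedBy supp := fun Λ A hA hne => by
    by_cases h₂ : W₂ A = 0
    · have h₁ : W₁ A ≠ 0 := fun h₁ => hne (by rw [Pi.sub_apply, h₁, h₂, sub_zero])
      exact hsupp₁ Λ A hA h₁
    · exact hsupp₂ Λ A hA h₂
  have hν' : ν ∈ perturbedGibbsMeasures (d := d) (fundamentalRep (Fin N)) (N * β) (W₁ + (W₂ - W₁))
      (fun Λ => supp Λ ∪ supp Λ) := by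
    simpa only [add_sub_cancel, Finset.union_self] using hν
  exact abs_integral_sub_integral_le_of_source_profile hd hW₁ hW₁b hsupp₁ hKR hrow hρ hV hVb hsuppV hoscD hbV hB ℓ hℓV
    hℓ hμ hν' hfm hfdep hM hδ

/-! ### The thermodynamic limit of the action at the clustering rate -/

/-- The box profile `⌊(n − ‖y‖_∞)₊ / max(1,R)⌋` grows by at most `1` along the member's range. -/
theorem floor_boxDepth_le_succ {supp : Finset (ZdEdge d) → Finset (Finset (ZdEdge d))} {R : ℝ}
    (hR : ∀ e, ∀ X ∈ supp {e}, e ∈ X → ∀ y ∈ X, ‖e.1 - y.1‖ ≤ R) (n : ℝ) (x : ZdEdge d) {y : ZdEdge d}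
    (hy : y ∈ perturbedNbr supp x) :
    ⌊max 0 (n - ‖x.1‖) / max 1 R⌋₊ ≤ ⌊max 0 (n - ‖y.1‖) / max 1 R⌋₊ + 1 := by
  have hR₀0 : (0 : ℝ) < max 1 R := zero_lt_one.trans_le (le_max_left _ _)
  have hxy : ‖x.1 - y.1‖ ≤ max 1 R := norm_sub_le_of_mem_perturbedNbr hR x hy
  have htri : ‖y.1‖ ≤ ‖x.1‖ + ‖x.1 - y.1‖ := by
    have := norm_sub_le_norm_sub_add_norm_sub y.1 x.1 (0 : Fin d → ℤ)
    -- `‖y‖ ≤ ‖y − x‖ + ‖x‖`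
    have h := norm_le_norm_add_norm_sub' y.1 x.1
    rw [norm_sub_rev] at h
    linarith
  have h1 : max 0 (n - ‖x.1‖) / max 1 R ≤ max 0 (n - ‖y.1‖) / max 1 R + 1 := by
    rw [div_add_one hR₀0.ne', div_le_div_iff_of_pos_right hR₀0]
    refine max_le (by positivity) ?_
    calc n - ‖x.1‖ ≤ (n - ‖y.1‖) + ‖x.1 - y.1‖ := by linarith
      _ ≤ max 0 (n - ‖y.1‖) + max 1 R := add_le_add (le_max_right _ _) hxy
  calc ⌊max 0 (n - ‖x.1‖) / max 1 R⌋₊ ≤ ⌊max 0 (n - ‖y.1‖) / max 1 R + 1⌋₊ := Nat.floor_mono h1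
    _ = ⌊max 0 (n - ‖y.1‖) / max 1 R⌋₊ + 1 := Nat.floor_add_one (div_nonneg (le_max_left _ _) hR₀0.le)

/-- **THE THERMODYNAMIC LIMIT OF THE ACTION AT THE CLUSTERING RATE — profile form.**  Member `(W, supp)` of range
`R`, a Dobrushin contraction with rows `≤ ρ < 1`, one-link oscillation witnesses `osc` with loads `≤ ε₀`; `W₂` any
bounded adapted potential listed by `supp` that agrees with `W` on every set inside the box of radius `n` and kills or
keeps every other term.  Then every DLR `μ` of `W` and EVERY DLR `ν` of `W₂` satisfy, for every bounded local `f` on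
`Δ` with Frobenius-Lipschitz vector `δ`:
`|∫ f dμ − ∫ f dν| ≤ (√N/2 · min(ε₀,4))/(1 − ρ) · Σ_{y ∈ Δ} ρ^{⌊(n − ‖y‖_∞)₊/max(1,R)⌋} δ_y`. -/
theorem abs_integral_sub_integral_le_of_truncation (hd : 1 ≤ d) {β ρ R ε₀ : ℝ} (n : ℝ)
    {W W₂ : Potential (ZdEdge d) (Matrix.specialUnitaryGroup (Fin N) ℂ)} (hW : W.IsAdapted)
    (hWb : ∀ X, ∃ C, ∀ U, |W X U| ≤ C) (hW₂ : W₂.IsAdapted)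
    {supp : Finset (ZdEdge d) → Finset (Finset (ZdEdge d))} (hsupp : W.IsSupportedBy supp)
    (hR : ∀ e, ∀ X ∈ supp {e}, e ∈ X → ∀ y ∈ X, ‖e.1 - y.1‖ ≤ R)
    {C : ZdEdge d → ZdEdge d → ℝ}
    (hKR : IsKRContraction (perturbedYM (d := d) (fundamentalRep (Fin N)) (N * β) W supp) suFrobDist
      (perturbedNbr supp) C)
    (hrow : ∀ x, ∑ y ∈ perturbedNbr supp x, C x y ≤ ρ) (hρ : ρ < 1)
    {osc : Finset (ZdEdge d) → ZdEdge d → ℝ} (hosc : ∀ X, Dobrushin.IsOscBound (W X) (osc X))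
    (hosca : ∀ e, ∑ X ∈ (supp {e}).filter (fun X => e ∈ X), osc X e ≤ ε₀)
    (hin : ∀ X : Finset (ZdEdge d), (∀ z ∈ X, ‖z.1‖ ≤ n) → W₂ X = W X)
    (hout : ∀ X : Finset (ZdEdge d), W₂ X = W X ∨ W₂ X = 0)
    {μ ν : Measure (LGConfig d (Matrix.specialUnitaryGroup (Fin N) ℂ))}
    (hμ : μ ∈ perturbedGibbsMeasures (d := d) (fundamentalRep (Fin N)) (N * β) W supp)
    (hν : ν ∈ perturbedGibbsMeasures (d := d) (fundamentalRep (Fin N)) (N * β) W₂ supp)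
    {f : LGConfig d (Matrix.specialUnitaryGroup (Fin N) ℂ) → ℝ} (hfm : Measurable f)
    {Δ : Finset (ZdEdge d)} (hfdep : DependsOn f (↑Δ : Set (ZdEdge d))) {M : ℝ} (hM : ∀ σ, |f σ| ≤ M)
    {δ : ZdEdge d → ℝ} (hδ : IsLipBound suFrobDist f δ) :
    |(∫ σ, f σ ∂μ) - ∫ σ, f σ ∂ν| ≤
      Real.sqrt N / 2 * min ε₀ 4 / (1 - ρ) * ∑ y ∈ Δ, ρ ^ ⌊max 0 (n - ‖y.1‖) / max 1 R⌋₊ * δ y := by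
  classical
  have hR₀0 : (0 : ℝ) < max 1 R := zero_lt_one.trans_le (le_max_left _ _)
  -- `W₂` is bounded and listed by `supp`
  have hW₂b : ∀ X, ∃ C, ∀ U, |W₂ X U| ≤ C := fun X => by
    rcases hout X with h | h
    · rw [h]; exact hWb X
    · exact ⟨0, fun U => by simp [h]⟩
  have hsupp₂ : W₂.IsSupportedBy supp := fun Λ A hA hne => by
    rcases hout A with h | h
    · exact hsupp Λ A hA (h ▸ hne)
    · exact (hne h).elim
  -- oscillation witnesses of the difference: `osc X` on the killed sets, `0` on the kept ones
  set oscD : Finset (ZdEdge d) → ZdEdge d → ℝ := fun X e => if W₂ X = W X then 0 else osc X e with hoscD_def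
  have hoscD : ∀ X, Dobrushin.IsOscBound ((W₂ - W) X) (oscD X) := fun X => by
    by_cases h : W₂ X = W X
    · refine ⟨fun e => by simp [hoscD_def, h], fun e σ τ _ => ?_⟩
      simp [hoscD_def, h, Pi.sub_apply]
    · have h0 : W₂ X = 0 := (hout X).resolve_left h
      refine ⟨fun e => by simp only [hoscD_def, if_neg h]; exact (hosc X).nonneg e, fun e σ τ hστ => ?_⟩
      have h1 := (hosc X).le e σ τ hστ
      have e1 : (W₂ - W) X σ - (W₂ - W) X τ = -(W X σ - W X τ) := by
        simp only [Pi.sub_apply, h0, Pi.zero_apply]; ring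
      simp only [hoscD_def, if_neg h]
      rw [e1, abs_neg]
      exact h1
  -- per-link loads: `≤ ε₀` everywhere, `0` at depth `≥ R` inside the box
  set bV : ZdEdge d → ℝ := fun e => ∑ X ∈ (supp {e}).filter (fun X => e ∈ X), oscD X e with hbV_def
  have hB : ∀ e, bV e ≤ ε₀ := fun e => by
    refine le_trans (Finset.sum_le_sum fun X _ => ?_) (hosca e)
    simp only [hoscD_def]
    split_ifs
    · exact (hosc X).nonneg e
    · exact le_rfl
  set ℓ : ZdEdge d → ℕ := fun y => ⌊max 0 (n - ‖y.1‖) / max 1 R⌋₊ with hℓ_def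
  have hℓV : ∀ e, ℓ e ≠ 0 → bV e ≤ 0 := by
    intro e he
    -- depth `n − ‖e‖ ≥ max(1,R) ≥ R`: every listed set through `e` lies inside the box, so it is kept
    have hdepth : max 1 R ≤ n - ‖e.1‖ := by
      refine (lt_or_ge (n - ‖e.1‖) (max 1 R)).resolve_left fun hlt => he ?_
      simp only [hℓ_def]
      refine Nat.floor_eq_zero.2 ?_
      rw [div_lt_one hR₀0]
      exact max_lt hR₀0 hlt
    refine le_of_eq (Finset.sum_eq_zero fun X hX => ?_)
    rw [Finset.mem_filter] at hX
    have hkeep : W₂ X = W X := hin X fun z hz => by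
      have h1 : ‖e.1 - z.1‖ ≤ R := hR e X hX.1 hX.2 z hz
      have h2 : ‖z.1‖ ≤ ‖e.1‖ + ‖e.1 - z.1‖ := by
        have h := norm_le_norm_add_norm_sub' z.1 e.1
        rw [norm_sub_rev] at h
        linarith
      linarith [le_max_right (1 : ℝ) R]
    simp [hoscD_def, hkeep]
  have key := abs_integral_sub_integral_le_of_members_profile hd hW hWb hW₂ hW₂b hsupp hsupp₂ hKR hrow hρ hoscD
    (bV := bV) (fun e => le_rfl) hB ℓ hℓV (fun x y hy => floor_boxDepth_le_succ hR n x hy) hμ hν hfm hfdep hM hδ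
  simpa only [hℓ_def] using key

/-- **THE THERMODYNAMIC LIMIT OF THE ACTION AT THE CLUSTERING RATE — Lipschitz-cylinder form.**  As above, for a
Lipschitz cylinder `F` (`Λ`, `K_F`) whose links have `‖base‖_∞ ≤ n₀ ≤ n`:
`|∫ F dμ − ∫ F dν| ≤ (√N/2 · min(ε₀,4))/(1 − max(ρ,½)) · e^{κ} · e^{−(κ/max(1,R)) (n − n₀)} · #Λ · K_F`,
`κ = −log max(ρ,½)` — exponentially small in the depth `n − n₀`, at the clustering rate of `UniformMassGapKR`,
whatever is done with the terms outside the box. -/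
theorem abs_integral_sub_integral_le_of_truncation_cylinder (hd : 1 ≤ d) {β ρ R ε₀ : ℝ} (n₀ n : ℝ)
    {W W₂ : Potential (ZdEdge d) (Matrix.specialUnitaryGroup (Fin N) ℂ)} (hW : W.IsAdapted)
    (hWb : ∀ X, ∃ C, ∀ U, |W X U| ≤ C) (hW₂ : W₂.IsAdapted)
    {supp : Finset (ZdEdge d) → Finset (Finset (ZdEdge d))} (hsupp : W.IsSupportedBy supp)
    (hR : ∀ e, ∀ X ∈ supp {e}, e ∈ X → ∀ y ∈ X, ‖e.1 - y.1‖ ≤ R)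
    {C : ZdEdge d → ZdEdge d → ℝ}
    (hKR : IsKRContraction (perturbedYM (d := d) (fundamentalRep (Fin N)) (N * β) W supp) suFrobDist
      (perturbedNbr supp) C)
    (hrow : ∀ x, ∑ y ∈ perturbedNbr supp x, C x y ≤ ρ) (hρ : ρ < 1)
    {osc : Finset (ZdEdge d) → ZdEdge d → ℝ} (hosc : ∀ X, Dobrushin.IsOscBound (W X) (osc X))
    (hosca : ∀ e, ∑ X ∈ (supp {e}).filter (fun X => e ∈ X), osc X e ≤ ε₀)
    (hin : ∀ X : Finset (ZdEdge d), (∀ z ∈ X, ‖z.1‖ ≤ n) → W₂ X = W X)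
    (hout : ∀ X : Finset (ZdEdge d), W₂ X = W X ∨ W₂ X = 0)
    {μ ν : Measure (LGConfig d (Matrix.specialUnitaryGroup (Fin N) ℂ))}
    (hμ : μ ∈ perturbedGibbsMeasures (d := d) (fundamentalRep (Fin N)) (N * β) W supp)
    (hν : ν ∈ perturbedGibbsMeasures (d := d) (fundamentalRep (Fin N)) (N * β) W₂ supp)
    {F : LGConfig d (Matrix.specialUnitaryGroup (Fin N) ℂ) → ℝ} {Λ : Finset (ZdEdge d)} {KF : ℝ≥0}
    (hF : IsLipschitzCylinder (fundamentalRep (Fin N)) F Λ KF) (hΛ : ∀ y ∈ Λ, ‖y.1‖ ≤ n₀) :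
    |(∫ σ, F σ ∂μ) - ∫ σ, F σ ∂ν| ≤
      Real.sqrt N / 2 * min ε₀ 4 / (1 - max ρ (1 / 2)) * exp (-Real.log (max ρ (1 / 2))) *
        exp (-(-Real.log (max ρ (1 / 2)) / max 1 R) * (n - n₀)) * (Λ.card * KF) := by
  classical
  set c' : ℝ := max ρ (1 / 2) with hc'
  have hc'0 : 0 < c' := lt_max_of_lt_right (by norm_num)
  have hc'1 : c' < 1 := max_lt hρ (by norm_num)
  have hrow' : ∀ x, ∑ y ∈ perturbedNbr supp x, C x y ≤ c' := fun x => (hrow x).trans (le_max_left _ _)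
  have hA : ∀ a b : Matrix.specialUnitaryGroup (Fin N) ℂ,
      dist (suEntries a) (suEntries b) ≤ 1 * suFrobDist a b :=
    fun a b => by rw [one_mul]; exact dist_suEntries_le_suFrobDist a b
  have key := abs_integral_sub_integral_le_of_truncation hd n hW hWb hW₂ hsupp hR hKR hrow' hc'1 hosc hosca hin hout
    hμ hν hF.measurable hF.dependsOn hF.abs_le (hF.isLipBound zero_le_one hA)
  refine key.trans ?_
  set κ : ℝ := -Real.log c' with hκ
  have hκ0 : 0 < κ := neg_pos.2 (Real.log_neg hc'0 hc'1)
  set R₀ : ℝ := max 1 R with hR₀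
  have hR₀0 : 0 < R₀ := zero_lt_one.trans_le (le_max_left _ _)
  have hε₀ : 0 ≤ ε₀ := by
    have hd0 : 0 < d := hd
    exact (Finset.sum_nonneg fun X _ => (hosc X).nonneg _).trans (hosca (0, ⟨0, hd0⟩))
  have hK0 : 0 ≤ Real.sqrt N / 2 * min ε₀ 4 / (1 - c') := by
    have : 0 < 1 - c' := sub_pos.2 hc'1
    have : 0 ≤ min ε₀ 4 := le_min hε₀ (by norm_num)
    positivity
  -- on `Λ` the profile is at least `⌊(n − n₀)/R₀⌋`, and `c'^{⌊D/R₀⌋} ≤ e^{κ} e^{−(κ/R₀) D}`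
  have hgeom : ∀ y ∈ Λ, c' ^ ⌊max 0 (n - ‖y.1‖) / R₀⌋₊ ≤ exp κ * exp (-(κ / R₀) * (n - n₀)) := by
    intro y hy
    have hm : ⌊(n - n₀) / R₀⌋₊ ≤ ⌊max 0 (n - ‖y.1‖) / R₀⌋₊ :=
      Nat.floor_mono (div_le_div_of_nonneg_right ((le_max_right _ _).trans'
        (by linarith [hΛ y hy])) hR₀0.le)
    refine (pow_le_pow_of_le_one hc'0.le hc'1.le hm).trans ?_
    have hfl : (n - n₀) / R₀ - 1 ≤ (⌊(n - n₀) / R₀⌋₊ : ℝ) := by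
      have := Nat.lt_floor_add_one ((n - n₀) / R₀)
      linarith
    rw [← exp_add, ← Real.rpow_natCast, Real.rpow_def_of_pos hc'0]
    refine exp_le_exp.2 ?_
    have hlog : Real.log c' = -κ := by rw [hκ, neg_neg]
    rw [hlog]
    have := mul_le_mul_of_nonneg_left hfl hκ0.le
    have e1 : -(κ / R₀) * (n - n₀) = -(κ * ((n - n₀) / R₀)) := by field_simp
    rw [e1]
    linarith
  have hsum : ∑ y ∈ Λ, c' ^ ⌊max 0 (n - ‖y.1‖) / R₀⌋₊ * (if y ∈ Λ then (1 : ℝ) * (KF : ℝ) else 0) ≤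
      exp κ * exp (-(κ / R₀) * (n - n₀)) * (Λ.card * KF) := by
    calc ∑ y ∈ Λ, c' ^ ⌊max 0 (n - ‖y.1‖) / R₀⌋₊ * (if y ∈ Λ then (1 : ℝ) * (KF : ℝ) else 0)
        ≤ ∑ y ∈ Λ, exp κ * exp (-(κ / R₀) * (n - n₀)) * KF := Finset.sum_le_sum fun y hy => by
          rw [if_pos hy, one_mul]
          exact mul_le_mul_of_nonneg_right (hgeom y hy) KF.2
      _ = exp κ * exp (-(κ / R₀) * (n - n₀)) * (Λ.card * KF) := by
          rw [Finset.sum_const, nsmul_eq_mul]; ring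
  calc Real.sqrt N / 2 * min ε₀ 4 / (1 - c') *
        ∑ y ∈ Λ, c' ^ ⌊max 0 (n - ‖y.1‖) / R₀⌋₊ * (if y ∈ Λ then (1 : ℝ) * (KF : ℝ) else 0)
      ≤ Real.sqrt N / 2 * min ε₀ 4 / (1 - c') * (exp κ * exp (-(κ / R₀) * (n - n₀)) * (Λ.card * KF)) :=
        mul_le_mul_of_nonneg_left hsum hK0
    _ = _ := by ring

/-! ### `SU(2)`, `ℤ⁴`: uniformly on the ball, closed-form door -/

/-- **`SU(2)`, `ℤ⁴` — the one state is the limit of the states of the truncated actions, at the clustering rate,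
UNIFORMLY on the tier-1 ball.**  `6|β_W| e^{ε₀} + e^{ε₀/2} √(2/3) ε₁ ≤ ρ`, `1/2 ≤ ρ < 1`: for every member `(W, supp)`
of `MemBallZd ε₀ ε₁ R` (bare coupling `β_W/2`), every truncation `W₂` keeping the terms inside the box of radius `n`
(adapted; `W₂ X = W X ∨ W₂ X = 0`), every DLR `μ` of `W`, EVERY DLR `ν` of `W₂`, and every Lipschitz cylinder `F`
(`Λ`, `K_F`) on links of `‖base‖_∞ ≤ n₀ ≤ n`:
`|∫ F dμ − ∫ F dν| ≤ √2 · min(ε₀,4)/(1 − ρ) · e^{−((1−ρ)/max(1,R)) (n − n₀)} · #Λ · K_F`. -/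
theorem su2_truncation_dim4 {βW ε₀ ε₁ ρ R n₀ n : ℝ} (hn : n₀ ≤ n)
    (hρ : 6 * |βW| * exp ε₀ + exp (ε₀ / 2) * Real.sqrt (2 / 3) * ε₁ ≤ ρ) (hhalf : 1 / 2 ≤ ρ) (hρ1 : ρ < 1)
    {W W₂ : Potential (ZdEdge 4) (Matrix.specialUnitaryGroup (Fin 2) ℂ)}
    {supp : Finset (ZdEdge 4) → Finset (Finset (ZdEdge 4))} (hmem : MemBallZd ε₀ ε₁ R W supp)
    (hW₂ : W₂.IsAdapted) (hin : ∀ X : Finset (ZdEdge 4), (∀ z ∈ X, ‖z.1‖ ≤ n) → W₂ X = W X)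
    (hout : ∀ X : Finset (ZdEdge 4), W₂ X = W X ∨ W₂ X = 0)
    {μ ν : Measure (LGConfig 4 (Matrix.specialUnitaryGroup (Fin 2) ℂ))}
    (hμ : μ ∈ perturbedGibbsMeasures (d := 4) (fundamentalRep (Fin 2)) (2 * (βW / 4)) W supp)
    (hν : ν ∈ perturbedGibbsMeasures (d := 4) (fundamentalRep (Fin 2)) (2 * (βW / 4)) W₂ supp)
    {F : LGConfig 4 (Matrix.specialUnitaryGroup (Fin 2) ℂ) → ℝ} {Λ : Finset (ZdEdge 4)} {KF : ℝ≥0}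
    (hF : IsLipschitzCylinder (fundamentalRep (Fin 2)) F Λ KF) (hΛ : ∀ y ∈ Λ, ‖y.1‖ ≤ n₀) :
    |(∫ σ, F σ ∂μ) - ∫ σ, F σ ∂ν| ≤
      Real.sqrt 2 * min ε₀ 4 / (1 - ρ) * exp (-((1 - ρ) / max 1 R) * (n - n₀)) * (Λ.card * KF) := by
  haveI : SecondCountableTopology (Matrix (Fin 2) (Fin 2) ℂ) :=
    inferInstanceAs (SecondCountableTopology (Fin 2 → Fin 2 → ℂ))
  haveI : SecondCountableTopology (Matrix.specialUnitaryGroup (Fin 2) ℂ) :=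
    Topology.IsEmbedding.subtypeVal.secondCountableTopology
  obtain ⟨osc, lip, hosc, hlip, hosca, hΛl⟩ := hmem.loads
  have hW : W.IsAdapted := fun X => ⟨hmem.dependsOn X, (hmem.continuous X).measurable⟩
  have hWb : ∀ X, ∃ C, ∀ U, |W X U| ≤ C := fun X => exists_bound_of_continuous (hmem.continuous X)
  have hc : (0 : ℝ) ≤ 2 / 3 := by norm_num
  have hP : ∀ B : Matrix (Fin 2) (Fin 2) ℂ, matrixOpNorm B ≤ |βW / 4| * (2 * (((4 : ℕ) : ℝ) - 1)) →
      ∀ (ψ : Matrix.specialUnitaryGroup (Fin 2) ℂ → ℝ) (M : ℝ), 0 ≤ M →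
        (∀ x y, |ψ x - ψ y| ≤ M * suFrobDist x y) →
        Var[ψ; (haarProbability (Matrix.specialUnitaryGroup (Fin 2) ℂ)).tilted
          fun g => ((2 : ℕ) : ℝ) * ((g : Matrix (Fin 2) (Fin 2) ℂ) * B).trace.re] ≤ 2 / 3 * M ^ 2 :=
    fun B hB ψ M hM hψ => oneLinkPoincareSUN_two_sharp _ B hB ψ M hM hψ
  have hVB := linVariance_of_poincare (N := 2) hP
  have hv : (0 : ℝ) ≤ 2 / 3 * ((2 : ℕ) : ℝ) ^ 2 := by norm_num
  have hKR := isKRContraction_perturbedYM_SU (d := 4) (by norm_num) (by norm_num) hc hv le_rfl hP hVB hW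
    (supp := supp) hosc hosca hlip
  have hsq : Real.sqrt (2 / 3 * (2 / 3 * ((2 : ℕ) : ℝ) ^ 2)) = 4 / 3 := by
    rw [show (2 / 3 * (2 / 3 * ((2 : ℕ) : ℝ) ^ 2) : ℝ) = (4 / 3) ^ 2 by norm_num, Real.sqrt_sq (by norm_num)]
  have hρ' : 6 * (((4 : ℕ) : ℝ) - 1) * |βW / 4| * (exp ε₀ * Real.sqrt (2 / 3 * (2 / 3 * ((2 : ℕ) : ℝ) ^ 2))) +
      exp (ε₀ / 2) * Real.sqrt (2 / 3) * ε₁ ≤ ρ := by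
    rw [hsq, abs_div, abs_of_pos (by norm_num : (0 : ℝ) < 4)]
    have e : 6 * (((4 : ℕ) : ℝ) - 1) * (|βW| / 4) * (exp ε₀ * (4 / 3)) = 6 * |βW| * exp ε₀ := by norm_num; ring
    rw [e]; exact hρ
  have hrow : ∀ x, ∑ y ∈ perturbedNbr supp x,
      (exp ε₀ * Real.sqrt (2 / 3 * (2 / 3 * ((2 : ℕ) : ℝ) ^ 2)) * |βW / 4| * linkInfluence x y +
        exp (ε₀ / 2) * Real.sqrt (2 / 3) * ∑ X ∈ (supp {x}).filter (fun X => x ∈ X), lip X y) ≤ ρ :=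
    fun x => (sum_perturbedNbr_coeff_le (d := 4) (by norm_num) (β := βW / 4) (c := 2 / 3)
      (v := 2 / 3 * ((2 : ℕ) : ℝ) ^ 2) (a := ε₀) hΛl x).trans hρ'
  have hμ' : μ ∈ perturbedGibbsMeasures (d := 4) (fundamentalRep (Fin 2)) ((2 : ℕ) * (βW / 4)) W supp := by
    simpa using hμ
  have hν' : ν ∈ perturbedGibbsMeasures (d := 4) (fundamentalRep (Fin 2)) ((2 : ℕ) * (βW / 4)) W₂ supp := by
    simpa using hν
  have key := abs_integral_sub_integral_le_of_truncation_cylinder (N := 2) (d := 4) (by norm_num) n₀ n hW hWb hW₂ hmem.supportedBy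
    hmem.range hKR hrow hρ1 hosc hosca hin hout hμ' hν' hF hΛ
  refine key.trans ?_
  have hε₀ : 0 ≤ min ε₀ 4 := by
    have h0 : 0 ≤ ε₀ :=
      (Finset.sum_nonneg fun X _ => (hosc X).nonneg _).trans (hosca ((0 : Fin 4 → ℤ), (0 : Fin 4)))
    exact le_min h0 (by norm_num)
  have hlin := screeningBound_linear (A := Real.sqrt ((2 : ℕ) : ℝ) / 2) (m := min ε₀ 4) (R := R) (D := n - n₀)
    (by positivity) hε₀ hhalf hρ1 (by linarith)
  have hΛK : (0 : ℝ) ≤ Λ.card * KF := by positivity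
  have h2 : Real.sqrt ((2 : ℕ) : ℝ) = Real.sqrt 2 := by norm_num
  calc _ ≤ 2 * (Real.sqrt ((2 : ℕ) : ℝ) / 2) * min ε₀ 4 / (1 - ρ) * exp (-((1 - ρ) / max 1 R) * (n - n₀)) *
        (Λ.card * KF) := mul_le_mul_of_nonneg_right hlin hΛK
    _ = _ := by rw [h2]; ring

end Summit.Ventures.YMGap.RobustBall

end
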